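import Summits.QuantumFields.YangMills.Theorems.BalabanUVNodesN07DbarNearRowsDent
import HarnessLib

/-!
# N07 [B11] (= [15] = [Balaban1985Variational]) Sect. F — MODULE 98: **(c′)‴ — THE NEAR ROWS OF THE BLOCK AVERAGES `Q_{j(c)}A(c)` ON MODULE 77b's NEAR CLASS, AT THE RECORD, IN THE
# DOUBLE-BAR CURRENCY** — for every cell `c` of print's (150) family `D″` in the near class «top, or both end blocks in `□_{j(c)+1}`» at a meeting, print-margin-clean datum under
# `NrmDbarWideOfRecord`: `‖Q_{j(c)}A(c)‖ ≤ L·(2·X₀·δ_j + 64·60800·ℓ²·(κ·ε_j·L)²)` — δ-LINEAR PLUS ε², the shape HBUDGET-NORM charges to `C·δ_j + Q·ε_j²` (MODULES 96∕97's rows of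
# `U̿^{(j(c))}(U^u)♮(c)`, [3] (26)'s logarithm, UST's second-order row `log U̿ = iηLˡ·Q_lA + O((Lˡηs)²)` with `η = L^{−j}`, `s = κ·ε_j·L`)

Cell `pub-ymgap`, seat `pub-ymgap-dag-n07-e` g28 (FAN-OUT §N07 row s3; LANE OWNER of the K0 road chart side), MODULE 98 (INTENT-98, cell bus; plan (α⁗-W) step 5 of (c′)‴ — the row itself;
the `hQnear`-binder adapter is MODULE 99).  `--kind proof --supports stmt-QuantumFields-20541 --as helper` (K0⁷); count-neutral; THEOREMS ONLY (0 `def`).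
[15] = [Balaban1985Variational]; [3] = [Balaban1985Averaging]; [6] = [Balaban1985RegularSpaces]; [4] = [Balaban1984PropagatorsII]; [III] = [Balaban1988Convergent]; [I] = [Balaban1987RG1].

WHY.  82b∕89″'s (c′) letter `hQnear` asks `‖Q_{j(c)}A(c)‖ ≤ β₁ ε δ j` on the near class with a `β₁` the knit's budget row can absorb (`C·δ_j + θ·ε_j + Q·ε_j²`, `θ ≤ 1∕16`): the (T2)
letter alone gives `κ·ε·L` (MODULE 78; ε-type with an O(1) coefficient — not absorbable), print's (160) gives δ-type rows for `log 𝒜` — and UST's second-order row ([3] Prop. 4) turns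
`log U̿^{(l)}(e^{iηA})(c)` into `η·Lˡ·Q_lA(c)` up to `64·60800·ℓ²·(Lˡηs)²` = an ε²-term.  MODULE 79 splits the near class into top bonds (MODULE 96's row) and level-(j−1) dent pairs
(MODULE 97's row); both rows are made δ_j-linear by `δ_{j−1} ≤ 2δ_j` and the log range `X₀·a₁ ≤ ½`; the weight `1∕(η·Lˡ) = L^{j−l} ≤ L` on the near class is the factor `L`.

WHAT IS PROVED (sorry-free; axioms standard).  §1 three numeric envelopes (`top_row_le_linear`, `dent_row_le_linear`, `div_weight_le`).  §2 ★★★ `norm_bondAvgIter_le_of_near_of_data (F N)` —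
the header's row for EVERY `c : BondIdx D″` in the near class, with `X₀ = 2·(d−1)·crad·(1+2C_L) + 10ℓ·τ_c + 14·t_c + 2(d+1)(L−1)·τ_c` (`t_c = (ℓ²∕4)·(4(d−1)(2L−1)+1)`,
`τ_c = (d(L−1)+1)·(d−1)(L−1)`), hypotheses = MODULES 96∕97's + the log-range guard `X₀·a₁ ≤ ½` + the UST budget `243200·ℓ²·(κ·ε·L) ≤ 1`.
HONEST SCOPE: by-name composition; `NrmDbarWideOfRecord`'s door is CONDITIONAL (`HThm4RecDbar`, N05-REC); (T1)∕(T2) are the door's rows; the guards are the K0 assembler's numerics;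
nothing of [15]∕[6]∕[3]∕[III] ANALYSIS asserted beyond the cited lemmas; (c′)‴ closes at MODULE 99 (the binder adapter); K0⁷ NOT closed; N07 NOT discharged; counts unmoved; one finite 𝕋⁴
programme at fixed ε — the route closes the conditional finite-𝕋⁴ rung `BalabanLadder.UV` ONLY; the YM mass gap (Clay) is NOT proved by any of this; nothing continuum ∕ ℝ⁴ ∕ OS.
No `def`, no `instance`, no `notation`, no `sorry`.

References: [15] (152)–(157) pp. 301–302, (160) p. 303, (144) p. 300, (147)–(150) p. 301; [3] (26) p. 22, (125)–(127) p. 36, Prop. 4 (134)–(135) p. 38; [6] Lemma 1 (1.25) p. 79,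
p. 98, (1.131) p. 99; [4] (2.1)–(2.3) p. 224, [Balaban1984PropagatorsI] (1.18) p. 20; [III] (2.10)–(2.13) pp. 255–257; [I] (0.4), (0.11) p. 253.
-/

set_option autoImplicit false

noncomputable section

open scoped BigOperators Matrix.Norms.L2Operator

namespace Summit.QuantumFields.YangMills.BalabanUVNodes.N07DbarNearRowsQA

open Literature.MathematicalPhysics.QuantumFieldTheory.Balaban1983to89
open Literature.MathematicalPhysics.QuantumFieldTheory.Balaban1983to89.Node00
open Literature.MathematicalPhysics.QuantumFieldTheory.Balaban1983to89.B15DeterminingSets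
open T4Continuum (T4Family)
open T4AxialGaugeSmallField (castSite boxBonds boxPlaqs)
open T4AxialGaugeRooted (axialGaugeAt)
open B12GaugeOrbits021 (IsResidual iter_gaugeAct_of_isResidual)
open B15Eq177GaugeInvariance (blockLift)
open B16Sect1Backgrounds (toMS)
open B15Eq112TorusCover (cover)
open B14DomainGeom (Pt Within)
open B7Prop1Local (InBox)
open B8Eq131Cubes (box cube sqLo sqHi tLo tHi ctr crad ctr_mem)
open B5Eq118OneStroke (iterBlockOf iterBlockOf_succ)
open B6SectADomainsV1 (Domains)
open B6SectAOperatorsV1 (BondIdx)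
open B10Eq27TorusAxialLog (unitsField toUField gaugeActT)
open B12RegularSpaces111 (gaugeU expI)
open GaugeField (gaugeAct)
open ExpMeanLog (expMeanLogSU deltaSU)
open Summit.QuantumFields.Balaban3D.Carriers (radialContourData)
open Summit.QuantumFields.YangMills.Theorems.FlatCubeOpsText (Adm22)
open Summit.QuantumFields.YangMills.Theorems.Prop8Chart (emlIterU expCfg)
open Summit.QuantumFields.YangMills.Theorems.Prop8ChartDoubleBar (vframeU dbarIterU)
open Summit.QuantumFields.YangMills.BalabanUVNodes.N07NormalisationDbarFrames (toUT)
open Summit.QuantumFields.YangMills.BalabanUVNodes.N07NormalisationDbarFramesWide (NrmDbarWideOfRecord)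
open Summit.QuantumFields.YangMills.BalabanUVNodes.N07NormalisationCrossingEnds (lamSite_or_forall_block_of_lamBond_end)
open Summit.QuantumFields.YangMills.BalabanUVNodes.N07NormalisationWideRows (dist1_gaugeAct_axialGaugeAt_le_of_mem_boxBonds abs_sub_ctr_le_crad Icc_chartBox_subset_Icc_printWindow)
open Summit.QuantumFields.YangMills.BalabanUVNodes.N07ShearSizeTopBox (mem_boxBonds_of_ends_mem_box)
open Summit.QuantumFields.YangMills.BalabanUVNodes.N07PrintWindowDataSmall (plaqSmallOn_printWindow_iter_of_data)
open Summit.QuantumFields.YangMills.BalabanUVNodes.N07ChartTopBoxDataSmall (two_mul_L_lt_sitesPerDir)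
open Summit.QuantumFields.YangMills.BalabanUVNodes.N07DentBlockDataSmall (plaqSmallOn_dentBlock_iter_of_data)
open Summit.QuantumFields.YangMills.BalabanUVNodes.N07DentRowsTwoBlocks (dist1_iter_within_le_of_box)
open Summit.QuantumFields.YangMills.BalabanUVNodes.N07RadialAxialTower (radialTower_gaugeAct_blockLift)
open Summit.QuantumFields.YangMills.BalabanUVNodes.N09AxialSelectionExists (iter_gaugeAct_blockLift)
open Summit.QuantumFields.YangMills.BalabanUVNodes.N07DataDownTheTowerBlowDown (dist1_plaqHol_iter_gaugeAct)
open Summit.QuantumFields.YangMills.BalabanUVNodes.N07NearRowsAtRecordWideClass (not_mem_genSet_of_embIter_not_mem)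
open Summit.QuantumFields.YangMills.BalabanUVNodes.N07RecordDomainsAdm22 (blockSat_seqOfRecord)
open Summit.QuantumFields.YangMills.BalabanUVNodes.N07FarRowsOfTowerLetters (exists_collar_labels_of_lamBond_meet)
open Summit.QuantumFields.YangMills.BalabanUVNodes.N07DbarCrossingEnds (lamBond_wide_of_near)
open Summit.QuantumFields.YangMills.BalabanUVNodes.N07DbarNearBondReading (norm_dbar_sub_one_le_of_cells norm_dbar_sub_one_le_of_outEnd_tgt norm_dbar_sub_one_le_of_outEnd_src)
open Summit.QuantumFields.YangMills.BalabanUVNodes.N07DbarDictionaryTransfer (emlIterU_unitsField_eq_iter_of_reads₂ emlIterU_eq_iter_apply_of_gaugeAct landau_reads_of_tower)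
open Summit.QuantumFields.YangMills.BalabanUVNodes.N07DbarNearRowsTop (not_mem_genSet_of_not_mem_wideOm)
open Summit.QuantumFields.YangMills.BalabanUVNodes.N07DentRowsTwoBlocks (dist1_iter_crossing_le_of_twoBlocks)
open Summit.QuantumFields.YangMills.BalabanUVNodes.N07DentPairDataSmall (plaqSmallOn_dentPair_iter_of_data)
open Summit.QuantumFields.YangMills.BalabanUVNodes.N07CubeTowerInsideRecordBelowTop (cubeDomains_Om_subset_meet_Om)
open Summit.QuantumFields.YangMills.BalabanUVNodes.N07NearRowsAtRecordWideClass (Icc_collar_of_inBox Icc_collar_add_e_of_inBox)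
open Summit.QuantumFields.YangMills.BalabanUVNodes.N07DbarCrossingEnds (cubeDomains_Om_subset_widen)
open B7Prop1Explicit (e e_apply)
open T4AxialGaugeSmallField (castSite_add_e)

open Summit.QuantumFields.YangMills.BalabanUVNodes.N07DbarNearRowsTop (norm_dbar_sub_one_top_le_of_data)
open Summit.QuantumFields.YangMills.BalabanUVNodes.N07DbarNearRowsDent (norm_dbar_sub_one_dent_le_of_data)
open Summit.QuantumFields.YangMills.BalabanUVNodes.N07DbarNearBondReading (norm_mlog_le_two_mul_of_le norm_bondAvgIter_le_of_dbar_reads)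
open Summit.QuantumFields.YangMills.BalabanUVNodes.N07CubeTowerInsideRecordBelowTop (near_cases_meet_both)
open LatticeFieldCalculus (bondAvgIter)
open MatrixLog (mlog)

/-! ## §1  Numeric envelopes -/

section Numeric

/-- The top row `r + 2f + 2f·r` is `δ_j`-linear under `δ_m ≤ 2δ_j` and `r ≤ ¼`: with `r = R·δ_j`, `f = Φ·δ_m`, `r + 2f + 2fr ≤ (R + 5Φ)·δ_j`. [folklore] -/
theorem top_row_le_linear {R Φ δj δm : ℝ} (hR : 0 ≤ R) (hΦ : 0 ≤ Φ) (hδj : 0 ≤ δj) (hcomp : δm ≤ 2 * δj) (hr : R * δj ≤ 1 / 4) :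
    R * δj + 2 * (Φ * δm) + 2 * (Φ * δm) * (R * δj) ≤ (R + 5 * Φ) * δj := by
  have h1 : Φ * δm ≤ Φ * (2 * δj) := mul_le_mul_of_nonneg_left hcomp hΦ
  have h2 : 2 * (Φ * δm) * (R * δj) ≤ 2 * (Φ * (2 * δj)) * (1 / 4) :=
    mul_le_mul (mul_le_mul_of_nonneg_left h1 (by norm_num)) hr (by positivity) (by positivity)
  nlinarith

/-- The dent row `r + 7·T·δ_m + D·(Ψ·δ_m)` is `δ_j`-linear under `δ_m ≤ 2δ_j`: `≤ (R + 14T + 2DΨ)·δ_j`. [folklore] -/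
theorem dent_row_le_linear {R T D Ψ δj δm : ℝ} (hT : 0 ≤ T) (hD : 0 ≤ D) (hΨ : 0 ≤ Ψ) (hcomp : δm ≤ 2 * δj) :
    R * δj + 7 * (T * δm) + D * (Ψ * δm) ≤ (R + 14 * T + 2 * D * Ψ) * δj := by
  have h1 : T * δm ≤ T * (2 * δj) := mul_le_mul_of_nonneg_left hcomp hT
  have h2 : D * (Ψ * δm) ≤ D * (Ψ * (2 * δj)) := mul_le_mul_of_nonneg_left (mul_le_mul_of_nonneg_left hcomp hΨ) hD
  nlinarith

/-- The weight of the near class: for `η·Lˡ·w = 1` with `1 ≤ w ≤ L` (`w = L^{j−l}`, `l ∈ {j−1, j}`), `0 ≤ a`, `0 ≤ C`, `0 < η`, `0 < Lˡ`: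
`(a + C·(Lˡ·η·s)²)∕(η·Lˡ) ≤ L·(a + C·s²)`. [folklore] -/
theorem div_weight_le {a C s η Ll w L : ℝ} (ha : 0 ≤ a) (hC : 0 ≤ C) (hη : 0 < η) (hLl : 0 < Ll) (hw1 : 1 ≤ w) (hwL : w ≤ L) (hq : η * Ll * w = 1) :
    (a + C * (Ll * η * s) ^ 2) / (η * Ll) ≤ L * (a + C * s ^ 2) := by
  have hηL : 0 < η * Ll := mul_pos hη hLl
  have hinv : (η * Ll)⁻¹ = w := by
    have := hq; field_simp; linarith [this]
  rw [div_eq_mul_inv, hinv]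
  have hq' : Ll * η = w⁻¹ := by
    have hw0 : w ≠ 0 := by linarith
    field_simp; linarith [hq]
  have hle1 : Ll * η ≤ 1 := by rw [hq']; exact inv_le_one_of_one_le₀ hw1
  have hs2 : (Ll * η * s) ^ 2 ≤ s ^ 2 := by
    rw [mul_pow]
    have h0 : 0 ≤ (Ll * η) ^ 2 := sq_nonneg _
    have h1 : (Ll * η) ^ 2 ≤ 1 := pow_le_one₀ (by positivity) hle1
    nlinarith [sq_nonneg s]
  have hw0 : 0 ≤ w := by linarith
  calc (a + C * (Ll * η * s) ^ 2) * w ≤ (a + C * s ^ 2) * w := by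
        exact mul_le_mul_of_nonneg_right (by nlinarith [mul_le_mul_of_nonneg_left hs2 hC]) hw0
    _ ≤ (a + C * s ^ 2) * L := mul_le_mul_of_nonneg_left hwL (by positivity)
    _ = L * (a + C * s ^ 2) := by ring

end Numeric

/-! ## §2  (c′)‴: the near rows of `Q_{j(c)} A (c)` -/

section Record

variable (F : T4Family) (N : ℕ) [NeZero N]
set_option maxHeartbeats 400000 in
/-- ★★★ **(c′)‴ — THE NEAR ROWS OF THE BLOCK AVERAGES AT THE RECORD, DOUBLE-BAR CURRENCY** (statement in the header): for every cell `c` of `D″` at a meeting, print-margin-clean datum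
`(m+1, idx)` in MODULE 77b's near class, `‖Q_{j(c)}A(c)‖ ≤ L·(2·X₀·δ_{m+1} + 64·60800·ℓ²·(κ·ε·L)²)`.
[cite: Balaban1985Variational, (152)–(157) pp.301–302, (160) p.303, (147)–(150) p.301; Balaban1985Averaging, (26) p.22, (125)–(127) p.36, Prop. 4 (134)–(135) p.38; Balaban1985RegularSpaces, Lemma 1 (1.25) p.79, p.98, (1.131) p.99; Balaban1984PropagatorsII, (2.1)–(2.3) p.224; Balaban1988Convergent, (2.10)–(2.13) pp.255–257] -/
theorem norm_bondAvgIter_le_of_near_of_data {ν : Stage7Numerics} {M : ℕ} {g : ℕ → ℝ} {K k : ℕ} (s : SeqOfRecord F ν M g K k)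
    (hsep : Sect2.SeqSeparated ν.M₁ s) (hkK : k ≤ (F.P K).m + (F.P K).K)
    (hgrid : ∀ j : ℕ, 1 ≤ j → j ≤ k → dCubeSide (F.P K).L M (RkOfRecord (F.P K).L ν.r (g j)) j ∣ (F.P K).sitesPerDir 0)
    {Mc ρ : ℕ} (hMc : 1 ≤ Mc) (hρ : 1 ≤ ρ) (hLρ : (F.P K).L ≤ ρ) (hfloor : (11 * (F.P K).d + 4 * ρ + Mc) * (F.P K).L + 3 ≤ ν.M₁)
    {δ : ℕ → ℝ} {a₁ : ℝ} (hδ : ∀ n, n ≤ k → 0 < δ n ∧ δ n ≤ a₁) (hcompδ : ∀ n, n < k → δ n ≤ 2 * δ (n + 1))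
    (hguard : (((((F.P K).d + 2) * (F.P K).L : ℕ) : ℝ) ^ 2 / 4) * ((4 * (((((F.P K).d - 1 : ℕ) : ℝ)) * ((2 * (F.P K).L - 1 : ℕ) : ℝ)) + 1) * a₁) < deltaSU (Fin N))
    (hτ : 600 * ((((F.P K).d + 2) * (F.P K).L : ℕ) : ℝ) * ((((F.P K).d * ((F.P K).L - 1) + 1 : ℕ) : ℝ) * (((((F.P K).d - 1 : ℕ) : ℝ) * (((F.P K).L - 1 : ℕ) : ℝ)) * a₁)) ≤ 1)
    -- the ONE log-range guard: `X₀·a₁ ≤ ½`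
    (hX : (2 * ((((F.P K).d - 1 : ℕ) : ℝ) * ((crad (sideP (F.P K) Mc ρ) ρ : ℕ) : ℝ) * (1 + 2 * ((((F.P K).L : ℝ) ^ 2 + 6 * ((((F.P K).d + 2) * (F.P K).L : ℕ) : ℝ) ^ 2) * (4 * ((((F.P K).d - 1 : ℕ) : ℝ) * ((2 * (F.P K).L - 1 : ℕ) : ℝ)) + 1)))) + 10 * ((((F.P K).d + 2) * (F.P K).L : ℕ) : ℝ) * ((((F.P K).d * ((F.P K).L - 1) + 1 : ℕ) : ℝ) * ((((F.P K).d - 1 : ℕ) : ℝ) * (((F.P K).L - 1 : ℕ) : ℝ))) + 14 * (((((F.P K).d + 2) * (F.P K).L : ℕ) : ℝ) ^ 2 / 4 * (4 * ((((F.P K).d - 1 : ℕ) : ℝ) * ((2 * (F.P K).L - 1 : ℕ) : ℝ)) + 1)) + 2 * ((((F.P K).d + 1) * ((F.P K).L - 1) : ℕ) : ℝ) * ((((F.P K).d * ((F.P K).L - 1) + 1 : ℕ) : ℝ) * ((((F.P K).d - 1 : ℕ) : ℝ) * (((F.P K).L - 1 : ℕ) : ℝ)))) * a₁ ≤ 1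 / 2)
    (W : MSField (F.P K) (SU N)) (h7 : Sect2.DataSmall7PTop (avOfRecord F N K) s.Ω (suppDomOfRecord F ν K s.Ω) k δ W)
    (U : GaugeField (F.P K) 0 (SU N)) (hfib : AgreeOn (genSet s.Ω k) (avgFamily (avOfRecord F N K) U) W)
    {j : ℕ} (hj1 : 1 ≤ j) (hjk : j ≤ k) (hjK : j + 1 ≤ (F.P K).m + (F.P K).K) (idx : Pt (F.P K).d)
    (hmeet : ∃ x ∈ box (F.P K).L (cornerP (F.P K) Mc ρ idx) (sideP (F.P K) Mc ρ) j, ∃ y : Pt (F.P K).d, cover (F.P K) y ∈ s.Ω j ∧ Within ((3 : ℕ) : ℤ) x y)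
    (hclean : j = k ∨ ∀ z ∈ box (F.P K).L (cornerP (F.P K) Mc ρ idx - ((2 * ρ : ℕ) : Pt (F.P K).d)) (sideP (F.P K) Mc ρ + 2 * (2 * ρ)) j,
      cover (F.P K) z ∉ s.Ω (j + 1))
    {n₀ : ℕ} (hn : ∀ κ, (tHi (cornerP (F.P K) Mc ρ idx) (sideP (F.P K) Mc ρ) ρ) κ ≤ (tLo (cornerP (F.P K) Mc ρ idx) ρ) κ + n₀) (hnN : n₀ + 1 < (F.P K).sitesPerDir j)
    (u : GaugeTransf (F.P K) 0 (SU N)) (A : PBond (F.P K) 0 → MatA N) {κ ε' : ℝ} (hκ : 0 ≤ κ) (hε' : 0 ≤ ε')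
    (hT1 : ∀ b ∈ (Sect2.regionOfSet (F.P K) (cover (F.P K) '' cube (F.P K).L (cornerP (F.P K) Mc ρ idx) (sideP (F.P K) Mc ρ) ρ j 0)).bonds,
      gaugeU (fun x => ιSU N (u x)) (fun b' => ιSU N (U b')) b = expI ((F.P K).eta j) (A b))
    (hT2 : ∀ j', j' ≤ j → ∀ b ∈ (Sect2.regionOfSet (F.P K) (cover (F.P K) '' cube (F.P K).L (cornerP (F.P K) Mc ρ idx) (sideP (F.P K) Mc ρ) ρ j j')).bonds,
      ‖A b‖ < κ * ε' * ((F.P K).L : ℝ) ^ (j - j'))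
    (hbud : 243200 * ((((F.P K).d + 2) * (F.P K).L : ℕ) : ℝ) ^ 2 * (κ * ε' * ((F.P K).L : ℝ)) ≤ 1)
    (hgd : 60 * ((((F.P K).d + 2) * (F.P K).L : ℕ) : ℝ) ^ 2 * (κ * ε' * ((F.P K).L : ℝ)) < deltaSU (Fin N))
    (hk : j ≤ (F.P K).m + (F.P K).K) (hN : NrmDbarWideOfRecord F N Mc ρ ν M g K k s U j idx u A) {R Mb : ℕ}
    (hAdm : Adm22 (domainsMeet (cubeDomains (F.P K) (cornerP (F.P K) Mc ρ idx - ((ρ : ℕ) : Pt (F.P K).d)) (sideP (F.P K) Mc ρ + 2 * ρ) ρ j hk)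
      (domainsOfSeq s.Ω j hk)) R Mb)
    (hRM : 2 * (F.P K).L ≤ R * Mb + 1)
    -- the cell, in MODULE 77b's near class
    (c : BondIdx (domainsMeet (cubeDomains (F.P K) (cornerP (F.P K) Mc ρ idx) (sideP (F.P K) Mc ρ) ρ j hk) (domainsOfSeq s.Ω j hk)))
    (hnear : (c.1.1 : ℕ) = j ∨
      (blockOf c.1.2.src ∈ (cubeDomains (F.P K) (cornerP (F.P K) Mc ρ idx) (sideP (F.P K) Mc ρ) ρ j hk).Om ((c.1.1 : ℕ) + 1) ∧
        blockOf c.1.2.tgt ∈ (cubeDomains (F.P K) (cornerP (F.P K) Mc ρ idx) (sideP (F.P K) Mc ρ) ρ j hk).Om ((c.1.1 : ℕ) + 1))) :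
    ‖bondAvgIter (c.1.1 : ℕ) A c.1.2‖ ≤ ((F.P K).L : ℝ) * (2 * ((2 * ((((F.P K).d - 1 : ℕ) : ℝ) * ((crad (sideP (F.P K) Mc ρ) ρ : ℕ) : ℝ) * (1 + 2 * ((((F.P K).L : ℝ) ^ 2 + 6 * ((((F.P K).d + 2) * (F.P K).L : ℕ) : ℝ) ^ 2) * (4 * ((((F.P K).d - 1 : ℕ) : ℝ) * ((2 * (F.P K).L - 1 : ℕ) : ℝ)) + 1)))) + 10 * ((((F.P K).d + 2) * (F.P K).L : ℕ) : ℝ) * ((((F.P K).d * ((F.P K).L - 1) + 1 : ℕ) : ℝ) * ((((F.P K).d - 1 : ℕ) : ℝ) * (((F.P K).L - 1 : ℕ) : ℝ))) + 14 * (((((F.P K).d + 2) * (F.P K).L : ℕ) : ℝ) ^ 2 / 4 * (4 * ((((F.P K).d - 1 : ℕ) : ℝ) * ((2 * (F.P K).L - 1 : ℕ) : ℝ)) + 1)) + 2 * ((((F.P K).d + 1) * ((F.P K).L - 1) : ℕ) : ℝ) * ((((F.P K).d * ((F.P K).L - 1) + 1 : ℕ) : ℝ) * ((((F.P K).d - 1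 : ℕ) : ℝ) * (((F.P K).L - 1 : ℕ) : ℝ)))) * δ j) + 64 * 60800 * ((((F.P K).d + 2) * (F.P K).L : ℕ) : ℝ) ^ 2 * (κ * ε' * ((F.P K).L : ℝ)) ^ 2) := by
  -- write `j = m + 1`
  obtain ⟨m, rfl⟩ : ∃ m, j = m + 1 := ⟨j - 1, by omega⟩
  -- ### letters (the three δ-free coefficients `R`, `Φ∕Ψ`-parts, `T`) and signs
  have hℓ0 : (0 : ℝ) ≤ ((((F.P K).d + 2) * (F.P K).L : ℕ) : ℝ) := Nat.cast_nonneg _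
  have hCL0 : (0 : ℝ) ≤ 1 + 2 * ((((F.P K).L : ℝ) ^ 2 + 6 * ((((F.P K).d + 2) * (F.P K).L : ℕ) : ℝ) ^ 2) *
      (4 * (((((F.P K).d - 1 : ℕ) : ℝ)) * ((2 * (F.P K).L - 1 : ℕ) : ℝ)) + 1)) := by positivity
  have hR0 : (0 : ℝ) ≤ (((F.P K).d - 1 : ℕ) : ℝ) * ((crad (sideP (F.P K) Mc ρ) ρ : ℕ) : ℝ) * (1 + 2 * ((((F.P K).L : ℝ) ^ 2 + 6 * ((((F.P K).d + 2) * (F.P K).L : ℕ) : ℝ) ^ 2) * (4 * ((((F.P K).d - 1 : ℕ) : ℝ) * ((2 * (F.P K).L - 1 : ℕ) : ℝ)) + 1))) := by positivity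
  have hΨ0 : (0 : ℝ) ≤ ((((F.P K).d * ((F.P K).L - 1) + 1 : ℕ) : ℝ) * ((((F.P K).d - 1 : ℕ) : ℝ) * (((F.P K).L - 1 : ℕ) : ℝ))) := by positivity
  have hT0 : (0 : ℝ) ≤ (((((F.P K).d + 2) * (F.P K).L : ℕ) : ℝ) ^ 2 / 4 * (4 * ((((F.P K).d - 1 : ℕ) : ℝ) * ((2 * (F.P K).L - 1 : ℕ) : ℝ)) + 1)) := by positivity
  have hD0 : (0 : ℝ) ≤ ((((F.P K).d + 1) * ((F.P K).L - 1) : ℕ) : ℝ) := by positivity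
  have hδj : 0 < δ (m + 1) := (hδ (m + 1) hjk).1
  have hδm : 0 < δ m := (hδ m (by omega)).1
  have hδja : δ (m + 1) ≤ a₁ := (hδ (m + 1) hjk).2
  have hcomp : δ m ≤ 2 * δ (m + 1) := hcompδ m (by omega)
  have hsA0 : 0 ≤ κ * ε' * ((F.P K).L : ℝ) := by positivity
  have hbud12800 : 12800 * ((((F.P K).d + 2) * (F.P K).L : ℕ) : ℝ) ^ 2 * (κ * ε' * ((F.P K).L : ℝ)) ≤ 1 := by
    linarith [mul_nonneg (pow_nonneg hℓ0 2) hsA0]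
  -- abbreviate the statement's `X₀` by a real `X0` with a defining equation (no `set`: keeps the atoms opaque for `nlinarith`)
  obtain ⟨X0, hX0def⟩ : ∃ X0 : ℝ, X0 = (2 * ((((F.P K).d - 1 : ℕ) : ℝ) * ((crad (sideP (F.P K) Mc ρ) ρ : ℕ) : ℝ) * (1 + 2 * ((((F.P K).L : ℝ) ^ 2 + 6 * ((((F.P K).d + 2) * (F.P K).L : ℕ) : ℝ) ^ 2) * (4 * ((((F.P K).d - 1 : ℕ) : ℝ) * ((2 * (F.P K).L - 1 : ℕ) : ℝ)) + 1)))) + 10 * ((((F.P K).d + 2) * (F.P K).L : ℕ) : ℝ) * ((((F.P K).d * ((F.P K).L - 1) + 1 : ℕ) : ℝ) * ((((F.P K).d - 1 : ℕ) : ℝ) * (((F.P K).L - 1 : ℕ) : ℝ))) + 14 * (((((F.P K).d + 2) * (F.P K).L : ℕ) : ℝ) ^ 2 / 4 * (4 * ((((F.P K).d - 1 : ℕ) : ℝ) * ((2 * (F.P K).L - 1 : ℕ) : ℝ)) + 1)) + 2 * ((((F.P K).d + 1) * ((F.P K).L - 1) : ℕ) : ℝ) * ((((F.P K).d * ((F.P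 K).L - 1) + 1 : ℕ) : ℝ) * ((((F.P K).d - 1 : ℕ) : ℝ) * (((F.P K).L - 1 : ℕ) : ℝ)))) :=
    ⟨_, rfl⟩
  rw [← hX0def] at hX ⊢
  have hX00 : 0 ≤ X0 := by rw [hX0def]; positivity
  have hrow4 : (((F.P K).d - 1 : ℕ) : ℝ) * ((crad (sideP (F.P K) Mc ρ) ρ : ℕ) : ℝ) * (1 + 2 * ((((F.P K).L : ℝ) ^ 2 + 6 * ((((F.P K).d + 2) * (F.P K).L : ℕ) : ℝ) ^ 2) * (4 * ((((F.P K).d - 1 : ℕ) : ℝ) * ((2 * (F.P K).L - 1 : ℕ) : ℝ)) + 1))) * δ (m + 1) ≤ 1 / 4 := by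
    have h1 : 2 * ((((F.P K).d - 1 : ℕ) : ℝ) * ((crad (sideP (F.P K) Mc ρ) ρ : ℕ) : ℝ) * (1 + 2 * ((((F.P K).L : ℝ) ^ 2 + 6 * ((((F.P K).d + 2) * (F.P K).L : ℕ) : ℝ) ^ 2) * (4 * ((((F.P K).d - 1 : ℕ) : ℝ) * ((2 * (F.P K).L - 1 : ℕ) : ℝ)) + 1)))) ≤ X0 := by
      rw [hX0def]; linarith [mul_nonneg hℓ0 hΨ0, mul_nonneg hD0 hΨ0, hT0]
    have h2 : X0 * δ (m + 1) ≤ 1 / 2 := le_trans (mul_le_mul_of_nonneg_left hδja (by rw [hX0def]; positivity)) hX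
    have h3 := mul_le_mul_of_nonneg_right h1 hδj.le
    linarith
  -- ### the bound `‖U̿^{(l)}(U^u)♮(c) − 1‖ ≤ X₀·δ_j` in the two near cases (MODULES 96 ∕ 97 + §1), together with the labels of the two blocks of `c` at the top level
  have hν1 : 1 ≤ ν.M₁ := by omega
  have hfl : 11 * (F.P K).d + 2 * ρ + Mc + 3 + 2 * ρ ≤ ν.M₁ := by
    have hL1 : 1 ≤ (F.P K).L := (F.P K).L_pos
    have : 11 * (F.P K).d + 4 * ρ + Mc ≤ (11 * (F.P K).d + 4 * ρ + Mc) * (F.P K).L := Nat.le_mul_of_pos_right _ hL1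
    omega
  obtain ⟨x₀, hx₀, y₀, hy₀, hxy₀⟩ := hmeet
  have hcases := near_cases_meet_both (P := F.P K) hν1 s hsep hρ hfl (by omega : 1 ≤ m + 1) hjk hk hx₀ hy₀ hxy₀ c
  -- η, s and the UST budget
  have hη : 0 < (F.P K).eta (m + 1) := by
    unfold Params.eta
    exact pow_pos (inv_pos.mpr (by exact_mod_cast (F.P K).L_pos)) _
  have hLη : ((F.P K).L : ℝ) ^ (m + 1) * (F.P K).eta (m + 1) = 1 := B12Eq115BackgroundPair.pow_mul_eta (F.P K) (m + 1)
  have hL1 : (1 : ℝ) ≤ (F.P K).L := by exact_mod_cast (F.P K).L_pos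
  have hpow1 : (m + 1) - (m + 1 - 1) = 1 := by omega
  -- destructure the cell
  obtain ⟨⟨⟨l, hl⟩, b⟩, hb⟩ := c
  simp only at hnear hcases hb ⊢
  rcases hcases with htop | ⟨hlev, hs, ht', hns, hnt⟩ | hfar
  · -- ##### TOP bond
    subst htop
    have hrow := norm_dbar_sub_one_top_le_of_data F N s hsep hkK hgrid hMc hρ hLρ hfloor hδ hcompδ hguard hτ W h7 U hfib hjk hjK idx ⟨x₀, hx₀, y₀, hy₀, hxy₀⟩ hclean hn hnN
      u A hκ hε' hT1 hT2 hbud12800 hgd hk hN hAdm hRM b hb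
    have hlin := top_row_le_linear hR0 (Φ := 2 * ((((F.P K).d + 2) * (F.P K).L : ℕ) : ℝ) * ((((F.P K).d * ((F.P K).L - 1) + 1 : ℕ) : ℝ) *
        ((((F.P K).d - 1 : ℕ) : ℝ) * (((F.P K).L - 1 : ℕ) : ℝ)))) (by positivity) hδj.le hcomp hrow4
    have hXb : ‖((dbarIterU (m + 1) (unitsField (toUField (gaugeAct u U))) b : (MatA N)ˣ) : MatA N) - 1‖ ≤ X0 * δ (m + 1) := by
      refine hrow.trans ?_
      refine le_trans (le_of_eq ?_) (hlin.trans ?_)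
      · ring
      · refine mul_le_mul_of_nonneg_right ?_ hδj.le
        rw [hX0def]; linarith [hR0, hT0, mul_nonneg hD0 hΨ0]
    have hX12 : X0 * δ (m + 1) ≤ 1 / 2 := le_trans (mul_le_mul_of_nonneg_left hδja hX00) hX
    have hm := norm_mlog_le_two_mul_of_le hXb hX12
    -- labels and reads of `b`
    obtain ⟨sl, sl', hsrc, htgt, hsl, hsl'⟩ := exists_collar_labels_of_lamBond_meet (domainsOfSeq s.Ω (m + 1) hk) (by omega : 1 ≤ m + 1) le_rfl hb
    have hreads : ∀ b₀ : PBond (F.P K) 0, (iterBlockOf (m + 1) b₀.src = b.src ∨ iterBlockOf (m + 1) b₀.src = b.tgt) →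
        (iterBlockOf (m + 1) b₀.tgt = b.src ∨ iterBlockOf (m + 1) b₀.tgt = b.tgt) →
        unitsField (toUField (gaugeAct u U)) b₀ = expCfg ((F.P K).eta (m + 1)) A b₀ ∧ ‖A b₀‖ ≤ κ * ε' * ((F.P K).L : ℝ) := by
      intro b₀ hbs hbt
      rw [hsrc, htgt] at hbs hbt
      obtain ⟨h1, h2, -⟩ := landau_reads_of_tower (k := m + 1) hk hLρ (by omega) le_rfl U u A hη.le hT1 hT2 hsl hsl' b₀ hbs hbt
      rw [hpow1, pow_one] at h2
      exact ⟨h1, h2.le⟩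
    have hbudget : 243200 * ((((F.P K).d + 2) * (F.P K).L : ℕ) : ℝ) ^ 2 * ((F.P K).L : ℝ) ^ (m + 1) * (F.P K).eta (m + 1) * (κ * ε' * ((F.P K).L : ℝ)) ≤ 1 := by
      have e : 243200 * ((((F.P K).d + 2) * (F.P K).L : ℕ) : ℝ) ^ 2 * ((F.P K).L : ℝ) ^ (m + 1) * (F.P K).eta (m + 1) * (κ * ε' * ((F.P K).L : ℝ)) =
          243200 * ((((F.P K).d + 2) * (F.P K).L : ℕ) : ℝ) ^ 2 * (κ * ε' * ((F.P K).L : ℝ)) * (((F.P K).L : ℝ) ^ (m + 1) * (F.P K).eta (m + 1)) := by ring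
      rw [e, hLη, mul_one]; exact hbud
    have hQ := norm_bondAvgIter_le_of_dbar_reads ((F.P K).eta (m + 1)) hη hk b A hsA0 hbudget (fun b₀ h1 h2 => (hreads b₀ h1 h2).2) _
      (fun b₀ h1 h2 => (hreads b₀ h1 h2).1) hm
    refine hQ.trans ?_
    exact div_weight_le (by positivity) (by positivity) hη (by positivity) le_rfl hL1 (by rw [mul_one, mul_comm]; exact hLη)
  · -- ##### DENT pair at level `m`
    have hlm : l = m := by omega
    subst hlm
    have hrow := norm_dbar_sub_one_dent_le_of_data F N s hsep hkK hgrid hMc hρ hLρ hfloor hδ hcompδ hguard W h7 U hfib hjk hjK idx ⟨x₀, hx₀, y₀, hy₀, hxy₀⟩ hclean hn hnN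
      u A hκ hε' hT1 hT2 hbud12800 hgd hk hN b hb hs ht' hns hnt
    have hlin := dent_row_le_linear (R := (((F.P K).d - 1 : ℕ) : ℝ) * (crad (sideP (F.P K) Mc ρ) ρ : ℕ) *
        (1 + 2 * ((((F.P K).L : ℝ) ^ 2 + 6 * ((((F.P K).d + 2) * (F.P K).L : ℕ) : ℝ) ^ 2) * (4 * (((((F.P K).d - 1 : ℕ) : ℝ)) * ((2 * (F.P K).L - 1 : ℕ) : ℝ)) + 1))))
      (δj := δ (l + 1)) hT0 hD0 hΨ0 hcomp
    have hXb : ‖((dbarIterU l (unitsField (toUField (gaugeAct u U))) b : (MatA N)ˣ) : MatA N) - 1‖ ≤ X0 * δ (l + 1) := by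
      refine hrow.trans ?_
      refine le_trans (le_of_eq ?_) (hlin.trans ?_)
      · ring
      · refine mul_le_mul_of_nonneg_right ?_ hδj.le
        rw [hX0def]; linarith [hR0, mul_nonneg hℓ0 hΨ0]
    have hX12 : X0 * δ (l + 1) ≤ 1 / 2 := le_trans (mul_le_mul_of_nonneg_left hδja hX00) hX
    have hm := norm_mlog_le_two_mul_of_le hXb hX12
    -- labels of the two blocks (top cube) and reads of `b`
    obtain ⟨t, htbox, htb⟩ := (mem_cubeDomains_Om_iff (by omega) le_rfl _).1 hs
    have hsrc : blockOf b.src = (castSite t : Site (F.P K) (l + 1)) := htb.symm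
    have htI : t ∈ Set.Icc (sqLo (F.P K).L (cornerP (F.P K) Mc ρ idx) ρ (l + 1) (l + 1) - 1)
        (sqHi (F.P K).L (cornerP (F.P K) Mc ρ idx) (sideP (F.P K) Mc ρ) ρ (l + 1) (l + 1) + 1) := Icc_collar_of_inBox htbox
    have htμI : t + e b.dir ∈ Set.Icc (sqLo (F.P K).L (cornerP (F.P K) Mc ρ idx) ρ (l + 1) (l + 1) - 1)
        (sqHi (F.P K).L (cornerP (F.P K) Mc ρ idx) (sideP (F.P K) Mc ρ) ρ (l + 1) (l + 1) + 1) := Icc_collar_add_e_of_inBox htbox b.dir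
    have htgt2 : ∃ t₂ : Pt (F.P K).d, (t₂ = t ∨ t₂ = t + e b.dir) ∧ blockOf b.tgt = (castSite t₂ : Site (F.P K) (l + 1)) := by
      rcases blockOf_shift_or hk b.src b.dir with hsame | hshift
      · exact ⟨t, Or.inl rfl, by rw [PBond.tgt, hsame, hsrc]⟩
      · exact ⟨t + e b.dir, Or.inr rfl, by rw [PBond.tgt, hshift, hsrc, castSite_add_e]⟩
    obtain ⟨t₂, ht₂, htgt⟩ := htgt2
    have ht₂I : t₂ ∈ Set.Icc (sqLo (F.P K).L (cornerP (F.P K) Mc ρ idx) ρ (l + 1) (l + 1) - 1)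
        (sqHi (F.P K).L (cornerP (F.P K) Mc ρ idx) (sideP (F.P K) Mc ρ) ρ (l + 1) (l + 1) + 1) := by
      rcases ht₂ with h1 | h1 <;> rw [h1]
      · exact htI
      · exact htμI
    have hIb : ∀ {z : Pt (F.P K).d}, z ∈ Set.Icc (sqLo (F.P K).L (cornerP (F.P K) Mc ρ idx) ρ (l + 1) (l + 1) - 1)
        (sqHi (F.P K).L (cornerP (F.P K) Mc ρ idx) (sideP (F.P K) Mc ρ) ρ (l + 1) (l + 1) + 1) →
        InBox (sqLo (F.P K).L (cornerP (F.P K) Mc ρ idx) ρ (l + 1) (l + 1) - 1) (sqHi (F.P K).L (cornerP (F.P K) Mc ρ idx) (sideP (F.P K) Mc ρ) ρ (l + 1) (l + 1) + 1) z :=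
      fun hz i => ⟨hz.1 i, hz.2 i⟩
    have hreads : ∀ b₀ : PBond (F.P K) 0, (iterBlockOf l b₀.src = b.src ∨ iterBlockOf l b₀.src = b.tgt) →
        (iterBlockOf l b₀.tgt = b.src ∨ iterBlockOf l b₀.tgt = b.tgt) →
        unitsField (toUField (gaugeAct u U)) b₀ = expCfg ((F.P K).eta (l + 1)) A b₀ ∧ ‖A b₀‖ ≤ κ * ε' * ((F.P K).L : ℝ) := by
      intro b₀ hbs hbt
      have hup : ∀ x : Site (F.P K) 0, (iterBlockOf l x = b.src ∨ iterBlockOf l x = b.tgt) →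
          (iterBlockOf (l + 1) x = coverAt (F.P K) (l + 1) t ∨ iterBlockOf (l + 1) x = coverAt (F.P K) (l + 1) t₂) := by
        intro x hx
        rw [iterBlockOf_succ]
        rcases hx with h1 | h1
        · left; rw [h1, hsrc]; rfl
        · right; rw [h1, htgt]; rfl
      obtain ⟨h1, h2, -⟩ := landau_reads_of_tower (k := l + 1) hk hLρ (by omega) le_rfl U u A hη.le hT1 hT2 (hIb htI) (hIb ht₂I) b₀ (hup _ hbs) (hup _ hbt)
      rw [hpow1, pow_one] at h2
      exact ⟨h1, h2.le⟩
    have hLm : ((F.P K).L : ℝ) ^ l * (F.P K).eta (l + 1) * ((F.P K).L : ℝ) = 1 := by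
      rw [← hLη]; ring
    have hbudget : 243200 * ((((F.P K).d + 2) * (F.P K).L : ℕ) : ℝ) ^ 2 * ((F.P K).L : ℝ) ^ l * (F.P K).eta (l + 1) * (κ * ε' * ((F.P K).L : ℝ)) ≤ 1 := by
      have hle : ((F.P K).L : ℝ) ^ l * (F.P K).eta (l + 1) ≤ 1 := by
        have h0 : 0 ≤ ((F.P K).L : ℝ) ^ l * (F.P K).eta (l + 1) := by positivity
        have h1 : ((F.P K).L : ℝ) ^ l * (F.P K).eta (l + 1) ≤ ((F.P K).L : ℝ) ^ l * (F.P K).eta (l + 1) * ((F.P K).L : ℝ) :=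
          le_mul_of_one_le_right h0 hL1
        rw [hLm] at h1; exact h1
      have e : 243200 * ((((F.P K).d + 2) * (F.P K).L : ℕ) : ℝ) ^ 2 * ((F.P K).L : ℝ) ^ l * (F.P K).eta (l + 1) * (κ * ε' * ((F.P K).L : ℝ)) =
          243200 * ((((F.P K).d + 2) * (F.P K).L : ℕ) : ℝ) ^ 2 * (κ * ε' * ((F.P K).L : ℝ)) * (((F.P K).L : ℝ) ^ l * (F.P K).eta (l + 1)) := by ring
      rw [e]
      have h0 : 0 ≤ 243200 * ((((F.P K).d + 2) * (F.P K).L : ℕ) : ℝ) ^ 2 * (κ * ε' * ((F.P K).L : ℝ)) := by positivity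
      exact (mul_le_of_le_one_right h0 hle).trans hbud
    have hQ := norm_bondAvgIter_le_of_dbar_reads ((F.P K).eta (l + 1)) hη (Nat.le_of_succ_le hk) b A hsA0 hbudget (fun b₀ h1 h2 => (hreads b₀ h1 h2).2) _
      (fun b₀ h1 h2 => (hreads b₀ h1 h2).1) hm
    refine hQ.trans ?_
    exact div_weight_le (by positivity) (by positivity) hη (by positivity) hL1 le_rfl (by rw [mul_comm ((F.P K).eta (l + 1)), hLm])
  · exact absurd hnear hfar

end Record

end Summit.QuantumFields.YangMills.BalabanUVNodes.N07DbarNearRowsQA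

end
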